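import Mathlib
import HarnessLib
import Summits.Ventures.LatticeQCDFlow.Exactness.CoordinateSubgroups

/-!
# The coordinate subgroups of `SU(N)` act transitively on the unit spheres of their coordinate subspaces

HONEST FRAMING: exact (Metropolis-corrected) sampling algorithms for lattice gauge theory;
figures of merit are autocorrelation/cost numbers at stated couplings and volumes; no
continuum-physics claim.

Venture `LatticeQCDFlow` (cell pub-lqcd), topic `Exactness`, FANOUT row 9 (eng-latcore, the
engine `latflow.core`: `update_link` in `csrc/latcore_template.c` runs, for `N ≥ 3`, one
Cabibbo–Marinari heat-bath hit per coordinate pair `(i, j)`, `i < j`, lexicographically).  NEW WORK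
of the cell over Mathlib and row 9's earlier files; nothing is cited as a fact.  Part of the
groundwork of the ergodicity proof for the SU(N) heat bath (`CabibboMarinariKernel.lean` and
`HeatBathSweepErgodic.lean` list "SU(N ≥ 3) Cabibbo–Marinari ergodicity" as NOT CLAIMED: one
subgroup hit does not dominate a Haar refresh).  The plan: the convolution of the embedded SU(2)
Haar measures over the lexicographic pairs dominates a multiple of Haar on `SU(N)` (induction over
coordinate subgroups through their orbit laws on spheres), hence the link update is Doeblin.
Builds on `CoordinateSubgroups.lean` (`coordSubgroup`, `pairHom`, `su2OfUnit`).

## What is proved (`n` a finite index type)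

* `sum_norm_sq_update_zero` — bookkeeping: `Σ_a ‖z|_{z_j := 0} a‖² + ‖z_j‖² = Σ_a ‖z_a‖²`.
* **`exists_mem_coordSubgroup_mulVec_eq`** — TRANSITIVITY: for `2 ≤ |s|`, `i ∈ s` and every
  complex unit vector `z` supported in `s` there is `g ∈ coordSubgroup s` with `g e_i = z`
  (induction on `|s|`: an element of the SU(2) pair subgroup `(i, j)` puts the weight `z_j` on a
  coordinate `j ≠ i` and `r = (1 − |z_j|²)^{1/2}` on `e_i`; the induction hypothesis in `s ∖ {j}`
  rotates `r e_i` to the rest of `z`); sphere form **`exists_mem_coordSubgroup_orbMap_eq`**;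
  `exists_orbMap_eq` (`SU(N)`, `N ≥ 2`, is transitive on `S^{2N−1}`).

NOT CLAIMED here: `|s| = 1` (there `coordSubgroup s` is trivial and NOT transitive on the circle);
anything measure-theoretic.
-/

namespace Summit.Ventures.LatticeQCDFlow.Exactness

open Matrix MeasureTheory WithLp Metric Complex

variable {n : Type*} [Fintype n] [DecidableEq n]

/-! ## §5 Transitivity of the coordinate subgroups on their spheres -/

section Transitive

/-- Squared moduli split off one coordinate. -/
theorem sum_norm_sq_update_zero (z : n → ℂ) (j : n) :
    ∑ a, ‖Function.update z j 0 a‖ ^ 2 + ‖z j‖ ^ 2 = ∑ a, ‖z a‖ ^ 2 := by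
  have h1 : ∑ a, ‖Function.update z j 0 a‖ ^ 2 = ∑ a ∈ Finset.univ.erase j, ‖z a‖ ^ 2 := by
    rw [← Finset.sum_erase_add _ _ (Finset.mem_univ j)]
    simp only [Function.update_self, norm_zero, ne_eq, OfNat.ofNat_ne_zero, not_false_eq_true,
      zero_pow, add_zero]
    refine Finset.sum_congr rfl fun a ha => ?_
    rw [Function.update_of_ne (Finset.ne_of_mem_erase ha)]
  rw [h1, Finset.sum_erase_add _ _ (Finset.mem_univ j)]

/-- **Transitivity**: for `2 ≤ |s|`, `i ∈ s` and every complex unit vector `z` supported in `s`,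
some element of `coordSubgroup s` sends `e_i` to `z`.  Induction on `|s|`: an element of the
SU(2) pair subgroup `(i, j)` puts the weight `z_j` on a coordinate `j ≠ i` and the remaining
weight `r = (1 − |z_j|²)^{1/2}` on `e_i`; the induction hypothesis in `s ∖ {j}` then rotates
`r e_i` to the rest of `z`. -/
theorem exists_mem_coordSubgroup_mulVec_eq :
    ∀ (k : ℕ) (s : Finset n), s.card = k → 2 ≤ k → ∀ i ∈ s, ∀ z : n → ℂ,
      (∀ a ∉ s, z a = 0) → ∑ a, ‖z a‖ ^ 2 = 1 →
        ∃ g ∈ coordSubgroup s, (g : Matrix n n ℂ) *ᵥ Pi.single i 1 = z := by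
  intro k
  induction k using Nat.strong_induction_on with
  | _ k ih =>
  intro s hsk hk i hi z hz0 hz1
  obtain ⟨j, hj, hji⟩ := Finset.exists_mem_ne (by omega : 1 < s.card) i
  by_cases hsupp : ∀ a, a ≠ i → a ≠ j → z a = 0
  · -- `z` lives on the pair `(i, j)`: one SU(2) element does it
    have hn : Complex.normSq (z i) + Complex.normSq (z j) = 1 := by
      rw [← hz1, ← Finset.sum_subset (Finset.subset_univ ({i, j} : Finset n))]
      · rw [Finset.sum_pair (Ne.symm hji), Complex.sq_norm, Complex.sq_norm]
      · intro a _ ha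
        have hai : a ≠ i := fun h => ha (by simp [h])
        have haj : a ≠ j := fun h => ha (by simp [h])
        simp [hsupp a hai haj]
    refine ⟨pairHom i j (Ne.symm hji) (su2OfUnit (z i) (z j) hn),
      coordSubgroup_mono ?_ (pairHom_mem_coordSubgroup i j (Ne.symm hji) _), ?_⟩
    · intro x hx
      simp only [Finset.mem_insert, Finset.mem_singleton] at hx
      rcases hx with rfl | rfl <;> assumption
    · rw [pairHom_mulVec_single, su2OfUnit_apply_00, su2OfUnit_apply_10]
      funext x
      by_cases hxi : x = i
      · subst hxi; simp [Ne.symm hji]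
      · by_cases hxj : x = j
        · subst hxj; simp [hji]
        · simp [hxi, hxj, hsupp x hxi hxj]
  · -- some weight off the pair: induction in `s.erase j`
    push Not at hsupp
    obtain ⟨a, hai, haj, hza⟩ := hsupp
    have has : a ∈ s := by
      by_contra h
      exact hza (hz0 a h)
    set s' := s.erase j with hs'
    have hjs' : j ∉ s' := Finset.notMem_erase j s
    have his' : i ∈ s' := Finset.mem_erase.2 ⟨Ne.symm hji, hi⟩
    have has' : a ∈ s' := Finset.mem_erase.2 ⟨haj, has⟩
    have hcard' : s'.card = k - 1 := by rw [hs', Finset.card_erase_of_mem hj, hsk]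
    have h3 : 3 ≤ k := by
      rw [← hsk]
      have : ({i, j, a} : Finset n) ⊆ s := by
        intro x hx
        simp only [Finset.mem_insert, Finset.mem_singleton] at hx
        rcases hx with rfl | rfl | rfl
        · exact hi
        · exact hj
        · exact has
      have hc : ({i, j, a} : Finset n).card = 3 := by
        rw [Finset.card_insert_of_notMem, Finset.card_pair (Ne.symm haj)]
        simp [Ne.symm hji, Ne.symm hai]
      calc 3 = ({i, j, a} : Finset n).card := hc.symm
        _ ≤ s.card := Finset.card_le_card this
    -- the part of `z` off `j`, and its length `r`
    set z' : n → ℂ := Function.update z j 0 with hz'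
    set R2 : ℝ := ∑ x, ‖z' x‖ ^ 2 with hR2
    have hR2j : R2 + ‖z j‖ ^ 2 = 1 := by rw [hR2, hz', sum_norm_sq_update_zero, hz1]
    have hza' : z' a = z a := by rw [hz', Function.update_of_ne haj]
    have hR2pos : 0 < R2 := by
      have h1 : ‖z' a‖ ^ 2 ≤ R2 :=
        Finset.single_le_sum (f := fun x => ‖z' x‖ ^ 2) (fun x _ => sq_nonneg _) (Finset.mem_univ a)
      have h2 : 0 < ‖z' a‖ ^ 2 := by
        rw [hza']; exact pow_pos (norm_pos_iff.2 hza) 2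
      exact lt_of_lt_of_le h2 h1
    set r : ℝ := Real.sqrt R2 with hr
    have hrpos : 0 < r := Real.sqrt_pos.2 hR2pos
    have hrsq : r ^ 2 = R2 := Real.sq_sqrt hR2pos.le
    -- the normalised off-`j` part, a unit vector supported in `s'`
    set w : n → ℂ := r⁻¹ • z' with hw
    have hw0 : ∀ x ∉ s', w x = 0 := by
      intro x hx
      rw [hw, Pi.smul_apply]
      by_cases hxj : x = j
      · rw [hxj, hz', Function.update_self, smul_zero]
      · have hxs : x ∉ s := fun h => hx (Finset.mem_erase.2 ⟨hxj, h⟩)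
        rw [hz', Function.update_of_ne hxj, hz0 x hxs, smul_zero]
    have hw1 : ∑ x, ‖w x‖ ^ 2 = 1 := by
      have hx : ∀ x, ‖w x‖ ^ 2 = r⁻¹ ^ 2 * ‖z' x‖ ^ 2 := fun x => by
        rw [hw, Pi.smul_apply, norm_smul, Real.norm_eq_abs, abs_inv, abs_of_pos hrpos, mul_pow]
      simp_rw [hx]
      rw [← Finset.mul_sum, ← hR2, ← hrsq, inv_pow, inv_mul_cancel₀ (pow_ne_zero 2 hrpos.ne')]
    -- induction hypothesis in `s'`
    obtain ⟨g₁, hg₁, hg₁i⟩ :=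
      ih (k - 1) (by omega) s' hcard' (by omega) i his' w hw0 hw1
    -- the pair element carrying the weights `r` and `z j`
    have hn : Complex.normSq (r : ℂ) + Complex.normSq (z j) = 1 := by
      rw [Complex.normSq_ofReal, ← sq, hrsq, Complex.normSq_eq_norm_sq, hR2j]
    refine ⟨g₁ * pairHom i j (Ne.symm hji) (su2OfUnit (r : ℂ) (z j) hn),
      (coordSubgroup s).mul_mem (coordSubgroup_mono (Finset.erase_subset j s) hg₁)
        (coordSubgroup_mono ?_ (pairHom_mem_coordSubgroup i j (Ne.symm hji) _)), ?_⟩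
    · intro x hx
      simp only [Finset.mem_insert, Finset.mem_singleton] at hx
      rcases hx with rfl | rfl <;> assumption
    · rw [Submonoid.coe_mul, ← mulVec_mulVec, pairHom_mulVec_single, su2OfUnit_apply_00,
        su2OfUnit_apply_10, mulVec_add, mulVec_smul, mulVec_smul, hg₁i,
        mulVec_single_of_not_mem hg₁ hjs']
      funext x
      rw [Pi.add_apply, Pi.smul_apply, Pi.smul_apply, hw, Pi.smul_apply, smul_eq_mul, smul_eq_mul,
        Complex.real_smul, ← mul_assoc, ← Complex.ofReal_mul, mul_inv_cancel₀ hrpos.ne',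
        Complex.ofReal_one, one_mul]
      by_cases hxj : x = j
      · subst hxj; simp [hz']
      · rw [hz', Function.update_of_ne hxj, Pi.single_eq_of_ne hxj, mul_zero, add_zero]

/-- **Transitivity on the sphere**: for `2 ≤ |s|`, `i ∈ s` and every point `z` of the unit sphere
with complex coordinates supported in `s`, some `g ∈ coordSubgroup s` has `g • e_i = z`. -/
theorem exists_mem_coordSubgroup_orbMap_eq {s : Finset n} (hs : 2 ≤ s.card) {i : n} (hi : i ∈ s)
    (z : S n) (hz : ∀ a ∉ s, cplx (z : E n) a = 0) :
    ∃ g ∈ coordSubgroup s, orbMap i g = z := by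
  obtain ⟨g, hg, hgz⟩ := exists_mem_coordSubgroup_mulVec_eq s.card s rfl hs i hi (cplx (z : E n)) hz
    (sum_norm_sq_cplx z)
  refine ⟨g, hg, Subtype.ext (cplx_injective ?_)⟩
  rw [cplx_orbMap, ← mulVec_single_one, hgz]

/-- In particular the whole group `SU(N)`, `N ≥ 2`, is transitive on `S^{2N−1}`. -/
theorem exists_orbMap_eq (h2 : 2 ≤ Fintype.card n) (i : n) (z : S n) :
    ∃ g : Matrix.specialUnitaryGroup n ℂ, orbMap i g = z := by
  obtain ⟨g, -, hg⟩ := exists_mem_coordSubgroup_orbMap_eq (s := Finset.univ)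
    (by rwa [Finset.card_univ]) (Finset.mem_univ i) z (fun a ha => absurd (Finset.mem_univ a) ha)
  exact ⟨g, hg⟩

end Transitive

end Summit.Ventures.LatticeQCDFlow.Exactness
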